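import Summits.Ventures.PercRepro.MSTightUpDown

/-!
# The TightExt half (i) of the local dichotomy, assembled from the comparability theorem

Dossier proofs/MINE1-theoremS.md, Addendum 52 §4 and supplement 1. For a covering subfamily
`K` of `P` (every `p ∈ P ∖ K` is eligible on one side: `p \\ K ⊆ D(K)` or `K \\ p ⊆ D(K)`) and a
tight `T ⊇ K` with `D(T)` a down-set (in the application a tight one-point extension
`T = K ∪ {m}`, where `D(T) = D(K)`; the identity `D(T) = D(K)` is not needed here — it enters only
through the two comparability hypotheses),
suppose every `P₁`-eligible member of `P` lies below a member of `T` and every `P₀`-eligible member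
lies above one (Addendum 52 §4 (b): true unless `T` is a column with `m` at the bottom or a row
with `m` at the top, handled separately in supplement 1). Then the comparability theorem
(`down_eq_or_up_eq_of_cover`, p509788) gives: **every `P₁`-eligible member lies in `T`, or every
`P₀`-eligible member lies in `T`** (`elig_subset_or_of_cover`) — for `T = K ∪ {m}` this is
`B⁺(K) ∖ K = {m}` or `B⁻(K) ∖ K = {m}`, the statement (i) of Addendum 50 suppl. 5
(`extension_side_of_cover`). In particular a tight one-point extension of a covering `K` whose
eligible members all lie below / above `T` is unique (`extension_unique_of_cover`).
-/

namespace PercRepro.MSTight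

open Finset
open scoped FinsetFamily

variable {α : Type*} [DecidableEq α]

/-- **(i) TightExt, assembled.** `K ⊆ T ⊆ P`, `P` and `T` tight, `D(T)` a down-set, `K`
covering, every `P₁`-eligible member of `P` below some member of `T` and every `P₀`-eligible one
above some member of `T`: then all `P₁`-eligible members lie in `T`, or all `P₀`-eligible members
do. -/
theorem elig_subset_or_of_cover {P T K : Finset (Finset α)} (hP : Tight P) (hT : Tight T)
    (hD : IsDownSet (T \\ T)) (hTP : T ⊆ P) (hKT : K ⊆ T)
    (hcov : ∀ p ∈ P, p ∉ K → (∀ k ∈ K, p \ k ∈ K \\ K) ∨ (∀ k ∈ K, k \ p ∈ K \\ K))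
    (hdown : ∀ p ∈ P, (∀ k ∈ K, p \ k ∈ K \\ K) → ∃ t ∈ T, p ⊆ t)
    (hup : ∀ p ∈ P, (∀ k ∈ K, k \ p ∈ K \\ K) → ∃ t ∈ T, t ⊆ p) :
    (∀ p ∈ P, (∀ k ∈ K, p \ k ∈ K \\ K) → p ∈ T) ∨
      (∀ p ∈ P, (∀ k ∈ K, k \ p ∈ K \\ K) → p ∈ T) := by
  have hcmp : ∀ p ∈ P, (∃ t ∈ T, p ⊆ t) ∨ (∃ t ∈ T, t ⊆ p) := by
    intro p hp
    by_cases hpK : p ∈ K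
    · exact Or.inl ⟨p, hKT hpK, subset_refl p⟩
    rcases hcov p hp hpK with h | h
    · exact Or.inl (hdown p hp h)
    · exact Or.inr (hup p hp h)
  rcases down_eq_or_up_eq_of_cover hP hT hD hTP hcmp with h | h
  · left
    intro p hp hpe
    rw [← h]
    exact mem_downIn.2 ⟨hp, hdown p hp hpe⟩
  · right
    intro p hp hpe
    rw [← h]
    exact mem_upIn.2 ⟨hp, hup p hp hpe⟩

/-- **(i) for a tight one-point extension `T = insert m K`:** `B⁺(K) ∖ K ⊆ {m}` or
`B⁻(K) ∖ K ⊆ {m}`. -/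
theorem extension_side_of_cover {P K : Finset (Finset α)} {m : Finset α} (hP : Tight P)
    (hT : Tight (insert m K)) (hD : IsDownSet (insert m K \\ insert m K)) (hmP : m ∈ P)
    (hKP : K ⊆ P)
    (hcov : ∀ p ∈ P, p ∉ K → (∀ k ∈ K, p \ k ∈ K \\ K) ∨ (∀ k ∈ K, k \ p ∈ K \\ K))
    (hdown : ∀ p ∈ P, (∀ k ∈ K, p \ k ∈ K \\ K) → ∃ t ∈ insert m K, p ⊆ t)
    (hup : ∀ p ∈ P, (∀ k ∈ K, k \ p ∈ K \\ K) → ∃ t ∈ insert m K, t ⊆ p) :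
    (∀ p ∈ P, p ∉ K → (∀ k ∈ K, p \ k ∈ K \\ K) → p = m) ∨
      (∀ p ∈ P, p ∉ K → (∀ k ∈ K, k \ p ∈ K \\ K) → p = m) := by
  have hTP : insert m K ⊆ P := insert_subset hmP hKP
  rcases elig_subset_or_of_cover hP hT hD hTP (subset_insert m K) hcov hdown hup with h | h
  · left
    intro p hp hpK hpe
    rcases mem_insert.1 (h p hp hpe) with h' | h'
    · exact h'
    · exact absurd h' hpK
  · right
    intro p hp hpK hpe
    rcases mem_insert.1 (h p hp hpe) with h' | h'
    · exact h'
    · exact absurd h' hpK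

/-- **Uniqueness of the extension** under the same hypotheses: a second member `m'` of `P ∖ K`
eligible on both sides equals `m`. -/
theorem extension_unique_of_cover {P K : Finset (Finset α)} {m : Finset α} (hP : Tight P)
    (hT : Tight (insert m K)) (hD : IsDownSet (insert m K \\ insert m K)) (hmP : m ∈ P)
    (hKP : K ⊆ P)
    (hcov : ∀ p ∈ P, p ∉ K → (∀ k ∈ K, p \ k ∈ K \\ K) ∨ (∀ k ∈ K, k \ p ∈ K \\ K))
    (hdown : ∀ p ∈ P, (∀ k ∈ K, p \ k ∈ K \\ K) → ∃ t ∈ insert m K, p ⊆ t)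
    (hup : ∀ p ∈ P, (∀ k ∈ K, k \ p ∈ K \\ K) → ∃ t ∈ insert m K, t ⊆ p)
    {m' : Finset α} (hm' : m' ∈ P) (hm'K : m' ∉ K) (h1 : ∀ k ∈ K, m' \ k ∈ K \\ K)
    (h0 : ∀ k ∈ K, k \ m' ∈ K \\ K) : m' = m := by
  rcases extension_side_of_cover hP hT hD hmP hKP hcov hdown hup with h | h
  · exact h m' hm' hm'K h1
  · exact h m' hm' hm'K h0

end PercRepro.MSTight
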